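import Mathlib
import Summits.Ventures.PercRepro2.TypedUntouched

/-!
# The kernel is linear in the attachment of `o` (blind cell PercRepro2, mine-2 g39, 2026-08-28;
`proofs/MINE2-GLUE.md` §8, row M2-84)

Every one of the eight terms of the kernel `KB` on states carries EXACTLY ONE factor depending on
the `o`-part `(L_o, H_o)` of exactly one copy (`σ_o` or `1_{o ∈ U}` of that copy).  Hence, writing
`zeroO s` for the state with the `o`-part erased,

  **`KB_linear_o`**: `KB x y w = KB x (zeroO y) (zeroO w) + KB (zeroO x) y (zeroO w) + KB (zeroO x) (zeroO y) w`

— the kernel is the sum of its three "one copy attached" parts — and **`KB_zeroO`**: with every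
`o`-part erased the kernel vanishes.  Both are polynomial identities in the side indicators once
the six `o`-bits are fixed (64 cases, `ring`).  The same for the symmetrised kernel
(`KBsym_linear_o`, `KBsym_zeroO`).  These are the algebra behind the typed PENDANT RULE of
`PendantRule.lean` (a pendant `o` of type `1, 2, 3` multiplies the typed count by `1, 2, 1` with its
edge opened) and behind the "a pendant `o` sees its host's star as its own" reading of
`proofs/MINE2-GADGET.md` §9.  Own code; standard axioms.
-/

namespace Summit.Ventures.PercRepro2

namespace CovForm

namespace OStar

open OneTyped Untouched

/-- The state with the `o`-part erased. -/
def zeroO (s : St) : St := (s.q', false, false, s.Lb, s.Hb, s.L3, s.H3)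

/-- `zeroO` keeps `q′`. -/
@[simp] lemma zeroO_q' (s : St) : (zeroO s).q' = s.q' := rfl
/-- `zeroO` erases `L_o`. -/
@[simp] lemma zeroO_Lo (s : St) : (zeroO s).Lo = false := rfl
/-- `zeroO` erases `H_o`. -/
@[simp] lemma zeroO_Ho (s : St) : (zeroO s).Ho = false := rfl
/-- `zeroO` keeps `L_b`. -/
@[simp] lemma zeroO_Lb (s : St) : (zeroO s).Lb = s.Lb := rfl
/-- `zeroO` keeps `H_b`. -/
@[simp] lemma zeroO_Hb (s : St) : (zeroO s).Hb = s.Hb := rfl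
/-- `zeroO` keeps `L₃`. -/
@[simp] lemma zeroO_L3 (s : St) : (zeroO s).L3 = s.L3 := rfl
/-- `zeroO` keeps `H₃`. -/
@[simp] lemma zeroO_H3 (s : St) : (zeroO s).H3 = s.H3 := rfl

/-- `qB` does not see the `o`-part. -/
@[simp] lemma qB_zeroO (s : St) : qB (zeroO s) = qB s := rfl

/-- `pdB` does not see the `o`-part. -/
@[simp] lemma pdB_zeroO (s : St) : pdB (zeroO s) = pdB s := rfl

/-- The side sign of an erased `o`-part. -/
@[simp] lemma sigB_false_false : sigB false false = 0 := rfl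

/-- The `U`-indicator of an erased `o`-part. -/
@[simp] lemma uB_false_false : uB false false = 0 := rfl

/-- **The kernel vanishes when every `o`-part is erased.** -/
theorem KB_zeroO (x y w : St) : KB (zeroO x) (zeroO y) (zeroO w) = 0 := by
  simp [KB]

/-- **The kernel is linear in the three `o`-parts**: it is the sum of its three one-copy-attached
parts (every term of `KB` carries exactly one `o`-factor, of exactly one copy). -/
theorem KB_linear_o (x y w : St) :
    KB x y w = KB x (zeroO y) (zeroO w) + KB (zeroO x) y (zeroO w) + KB (zeroO x) (zeroO y) w := by
  simp only [KB, qB_zeroO, pdB_zeroO, zeroO_Lo, zeroO_Ho, zeroO_Lb, zeroO_Hb, zeroO_L3, zeroO_H3,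
    sigB_false_false, uB_false_false, mul_zero, zero_mul, add_zero, zero_add, sub_zero, zero_sub]
  ring

/-- The symmetrised kernel vanishes when every `o`-part is erased. -/
theorem KBsym_zeroO (x y w : St) : KBsym (zeroO x) (zeroO y) (zeroO w) = 0 := by
  simp [KBsym, KB_zeroO]

/-- **The symmetrised kernel is linear in the three `o`-parts.** -/
theorem KBsym_linear_o (x y w : St) :
    KBsym x y w =
      KBsym x (zeroO y) (zeroO w) + KBsym (zeroO x) y (zeroO w) + KBsym (zeroO x) (zeroO y) w := by
  unfold KBsym
  rw [KB_linear_o x y w, KB_linear_o x w y, KB_linear_o y x w, KB_linear_o y w x,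
    KB_linear_o w x y, KB_linear_o w y x]
  rw [KB_linear_o x (zeroO y) (zeroO w), KB_linear_o x (zeroO w) (zeroO y),
    KB_linear_o (zeroO y) x (zeroO w), KB_linear_o (zeroO y) (zeroO w) x,
    KB_linear_o (zeroO w) x (zeroO y), KB_linear_o (zeroO w) (zeroO y) x,
    KB_linear_o (zeroO x) y (zeroO w), KB_linear_o (zeroO x) (zeroO w) y,
    KB_linear_o y (zeroO x) (zeroO w), KB_linear_o y (zeroO w) (zeroO x),
    KB_linear_o (zeroO w) (zeroO x) y, KB_linear_o (zeroO w) y (zeroO x),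
    KB_linear_o (zeroO x) (zeroO y) w, KB_linear_o (zeroO x) w (zeroO y),
    KB_linear_o (zeroO y) (zeroO x) w, KB_linear_o (zeroO y) w (zeroO x),
    KB_linear_o w (zeroO x) (zeroO y), KB_linear_o w (zeroO y) (zeroO x)]
  have hz : ∀ s : St, zeroO (zeroO s) = zeroO s := fun s => rfl
  simp only [hz, KB_zeroO]
  ring

end OStar

end CovForm

end Summit.Ventures.PercRepro2
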